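import Mathlib.RingTheory.Valuation.Integers
import Mathlib.GroupTheory.Torsion
import Mathlib.GroupTheory.QuotientGroup.Defs
import Mathlib.GroupTheory.GroupAction.Defs
import Mathlib.Algebra.Group.Subgroup.Actions
import Mathlib.Algebra.Ring.Action.Basic
import HarnessLib

/-!
# L-LANA objects II: the local unit data `O^▷ ⊇ O^× ⊇ O^μ`, `O^{×μ}`, and the `×μ`-Kummer structure (LANA §0.4 (b), §3.6, §3.9)

Record-only file (D-0012) of the abc-iut cell (seat abc-iut-c312-4, L-LANA level, plan/LLANA-SPEC N3 and
the concrete half of N4); TAKES NO SIDE on [IUTchIII] Cor. 3.12. It constructs, as REAL Mathlib objects,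
the reference local data of Project LANA's interim report (bib `LANA2026Report`, read on the page) from a
field `K` (the report's `K̄_v`) with a nonarchimedean valuation `| · | = w` and a group `G` (the report's
`G_v = Gal(K̄_v/K_v)`) acting on `K` by valuation-preserving ring automorphisms:

* §0.4 (b) p. 8: "`O^×_k = {a ∈ k | |a| = 1}` (group by the multiplication of `k`); `O^▷_k = {a ∈ k |
  0 < |a| ≤ 1}` (monoid by the multiplication of `k`); `O_k = {a ∈ k | |a| ≤ 1}` (subring of `k`). Note
  that `O^▷_k = O_k ∖ {0}`, and that `O^×_k` is the group of invertible elements of the monoid `O^▷_k`."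
  — `intMonoid` (`O^▷`), `unitGrp` (`O^×`), Mathlib's `Valuation.integer` (`O`); `coe_intMonoid_eq`,
  `isUnit_intMonoid_iff`.
* §3.6 p. 20: "`O^μ_v := (O^×_v)_{tor} ⊆ O^×_v`", "`G_v ↷ O^{×μ}_v := O^×_v/O^μ_v`" — `torsionUnits`,
  `UnitsModTorsion`, with the `G`-action on `O^×` (`unitGrp.instMulDistribMulAction`) DESCENDING to
  `O^{×μ}` (`UnitsModTorsion.instMulDistribMulAction`: torsion is carried to torsion by every endomorphism).
* §3.9 p. 21: "When an object such as `O_v`, `O^▷_v`, or `O^×_v` is given as an abstract ring or monoid, the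
  version without an overline is defined by its `G_v`-invariant portion … `O^▷_v := (O^▷_v)^{G_v}` … the
  version without an overline of `O^{×μ}_v` is defined as the image of `O^×_v := (O^×_v)^{G_v} → O^{×μ}_v`";
  Def. 3.9.1 p. 22: "For every open subgroup `H < G_v` of `G_v`, define `I^κ_H` to be the image of
  `(O^×_v)^H` under `O^×_v ↠ O^{×μ}_v`. The resulting family `{I^κ_H}_{H < G_v open}` is called the
  `×μ`-Kummer structure or compact structure of `G_v ↷ O^{×μ}_v`." — `unitInvariants H` (`(O^×)^H`),
  `kummerStructure H` (`I^κ_H`), `kummerStructure_antitone`; the bare versions `intMonoidInv`, `unitInv`,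
  `unitsModTorsionBare`.

Modelling notes. (i) Pure algebra: `H` ranges over ALL subgroups of `G`; openness (the topology of `G_v`)
and the topologies of `O^×`, `O^{×μ}` (subspace of `K̄_v^×`, quotient topology) are attached when these data
are packaged as GM-data with compact structure (`LanaGMData.GMDataK`, sibling `LanaStrips.lean`). (ii) The
hypothesis that `G` preserves the valuation (`IsValPreserving`) is what makes `O^▷`, `O^×` `G`-stable; for
`Gal(K̄_v/K_v)` it holds (uniqueness of the extended valuation) — a classical fact supplied by the
absolute-Galois-group interface (seat abc-iut-L4-t1), not proved here. (iii) §3.9 p. 21: "`O^{×μ}_v` cannot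
be determined from the abstract GM-data `G_v ↷ O^{×μ}_v` alone" is the report's remark that the image of the
invariants is not the invariants of the quotient; recorded, not formalised. NOT here: cyclotomes `Λ(·)` and
Kummer maps (LLANA-SPEC N2/N13, seat abc-iut-L2-t3), log-shells (N10), any judgement.
-/

namespace Summit.ABC
namespace IUTFork

/-! ## 1. `O^▷`, `O^×` of a valued field (§0.4 (b)) -/

section Valued

variable {K : Type} [Field K] {Γ₀ : Type} [LinearOrderedCommGroupWithZero Γ₀] (w : Valuation K Γ₀)

/-- **§0.4 (b)**: "`O^▷_k = {a ∈ k | 0 < |a| ≤ 1}` (monoid by the multiplication of `k`)".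
[cite: LANA2026Report, §0.4 (b) p. 8] -/
def intMonoid : Submonoid K where
  carrier := {a | 0 < w a ∧ w a ≤ 1}
  one_mem' := by simp
  mul_mem' := by
    rintro a b ⟨ha, ha'⟩ ⟨hb, hb'⟩
    refine ⟨?_, ?_⟩
    · rw [map_mul]; exact mul_pos ha hb
    · rw [map_mul]; exact mul_le_one' ha' hb'

/-- Membership in `O^▷`. [cite: LANA2026Report, §0.4 (b) p. 8] -/
theorem mem_intMonoid_iff (a : K) : a ∈ intMonoid w ↔ 0 < w a ∧ w a ≤ 1 := Iff.rfl

/-- "Note that `O^▷_k = O_k ∖ {0}`" (`O_k = {a | |a| ≤ 1}` is Mathlib's `Valuation.integer`).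
[cite: LANA2026Report, §0.4 (b) p. 8] -/
theorem coe_intMonoid_eq : (intMonoid w : Set K) = (w.integer : Set K) \ {0} := by
  ext a
  simp only [SetLike.mem_coe, mem_intMonoid_iff, Set.mem_sdiff, Set.mem_singleton_iff,
    Valuation.mem_integer_iff, Valuation.pos_iff]
  tauto

/-- **§0.4 (b)**: "`O^×_k = {a ∈ k | |a| = 1}` (group by the multiplication of `k`)", as a subgroup of
`k^×`. [cite: LANA2026Report, §0.4 (b) p. 8] -/
def unitGrp : Subgroup Kˣ where
  carrier := {u | w (u : K) = 1}
  one_mem' := by simp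
  mul_mem' := by
    intro a b ha hb
    simp only [Set.mem_setOf_eq, Units.val_mul, map_mul] at *
    rw [ha, hb, one_mul]
  inv_mem' := by
    intro a ha
    simp only [Set.mem_setOf_eq, Units.val_inv_eq_inv_val, map_inv₀] at *
    rw [ha, inv_one]

/-- Membership in `O^×`. [cite: LANA2026Report, §0.4 (b) p. 8] -/
theorem mem_unitGrp_iff (u : Kˣ) : u ∈ unitGrp w ↔ w (u : K) = 1 := Iff.rfl

/-- An element of `O^×` lies in `O^▷`. [cite: LANA2026Report, §0.4 (b) p. 8] -/
theorem val_mem_intMonoid (u : unitGrp w) : ((u : Kˣ) : K) ∈ intMonoid w := by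
  have h : w ((u : Kˣ) : K) = 1 := u.2
  exact ⟨by rw [h]; exact one_pos, h.le⟩

/-- "`O^×_k` is the group of invertible elements of the monoid `O^▷_k`": an element of `O^▷` is invertible
in `O^▷` iff `|a| = 1`. [cite: LANA2026Report, §0.4 (b) p. 8] -/
theorem isUnit_intMonoid_iff (a : intMonoid w) : IsUnit a ↔ w (a : K) = 1 := by
  constructor
  · rintro ⟨u, rfl⟩
    have h1 : w ((u : intMonoid w) : K) * w ((u⁻¹ : (intMonoid w)ˣ) : intMonoid w) = 1 := by
      rw [← map_mul, ← Submonoid.coe_mul, ← Units.val_mul, mul_inv_cancel, Units.val_one,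
        Submonoid.coe_one, map_one]
    exact le_antisymm (u : intMonoid w).2.2
      (by
        have h2 := (u⁻¹ : (intMonoid w)ˣ).val.2.2
        calc (1 : Γ₀) = w ((u : intMonoid w) : K) * w ((u⁻¹ : (intMonoid w)ˣ) : intMonoid w) := h1.symm
          _ ≤ w ((u : intMonoid w) : K) * 1 := by gcongr
          _ = _ := mul_one _)
  · intro h
    have ha : (a : K) ≠ 0 := (Valuation.pos_iff w).mp a.2.1
    refine ⟨⟨a, ⟨(a : K)⁻¹, ?_⟩, ?_, ?_⟩, rfl⟩
    · refine ⟨?_, ?_⟩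
      · rw [map_inv₀, h, inv_one]; exact one_pos
      · rw [map_inv₀, h, inv_one]
    · exact Subtype.ext (mul_inv_cancel₀ ha)
    · exact Subtype.ext (inv_mul_cancel₀ ha)

/-! ## 2. `O^μ := (O^×)_{tor}` and `O^{×μ} := O^×/O^μ` (§3.6) -/

/-- **§3.6 p. 20**: the "cyclotomic portion" "`O^μ_v := (O^×_v)_{tor} ⊆ O^×_v`" — the torsion subgroup
(the roots of unity). [cite: LANA2026Report, §3.6 p. 20] -/
abbrev torsionUnits : Subgroup (unitGrp w) := CommGroup.torsion (unitGrp w)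

/-- **§3.6 p. 20**: "`O^{×μ}_v := O^×_v/O^μ_v`" — "a unit-group-like portion of `K̄_v` that is isolated from
the deformation of the value-group portion, and functions as a "common container" shared between the two
Hodge Theaters." [cite: LANA2026Report, §3.6 p. 20] -/
abbrev UnitsModTorsion : Type := unitGrp w ⧸ torsionUnits w

/-- The projection `O^× ↠ O^{×μ}`. [cite: LANA2026Report, §3.6 p. 20] -/
abbrev toUnitsModTorsion : unitGrp w →* UnitsModTorsion w := QuotientGroup.mk' (torsionUnits w)

end Valued

/-! ## 3. The `G`-actions: `G ↷ O^▷`, `G ↷ O^×`, descending to `G ↷ O^{×μ}` (§3.5–3.6) -/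

section Action

variable {K : Type} [Field K] {Γ₀ : Type} [LinearOrderedCommGroupWithZero Γ₀] (w : Valuation K Γ₀)
  (G : Type) [Group G] [MulSemiringAction G K]

/-- HYPOTHESIS CLASS: `G` acts on `K` (by ring automorphisms, `MulSemiringAction`) PRESERVING the
valuation, `|g·a| = |a|` — as `G_v = Gal(K̄_v/K_v)` does on `K̄_v` ("`G_v` is defined as the group of
suitable automorphisms of the field `K̄_v`", §3.5 p. 19; preservation of `| · |` = uniqueness of the
extended valuation, a classical fact supplied with the Galois-group interface, modelling note (ii)).
[cite: LANA2026Report, §3.5 p. 19] -/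
@[cite "LANA2026Report" "§3.5 p. 19"] class IsValPreserving : Prop where
  /-- `|g·a| = |a|` -/
  val_smul : ∀ (g : G) (a : K), w (g • a) = w a

variable [IsValPreserving w G]

/-- `G ↷ O^▷`: the action restricts (`|g·a| = |a|`, `g·a ≠ 0`). [cite: LANA2026Report, §3.7 p. 20] -/
instance intMonoid.instMulDistribMulAction : MulDistribMulAction G (intMonoid w) where
  smul g a := ⟨g • (a : K), by
    rw [mem_intMonoid_iff, IsValPreserving.val_smul]; exact a.2⟩
  one_smul a := Subtype.ext (one_smul G (a : K))
  mul_smul g h a := Subtype.ext (mul_smul g h (a : K))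
  smul_mul g a b := Subtype.ext (smul_mul' g (a : K) (b : K))
  smul_one g := Subtype.ext (smul_one g)

/-- The action on `O^▷`, on underlying elements. [cite: LANA2026Report, §3.7 p. 20] -/
@[simp] theorem intMonoid.coe_smul (g : G) (a : intMonoid w) : ((g • a : intMonoid w) : K) = g • (a : K) :=
  rfl

/-- `G ↷ O^×` ("the group of units `O^×_v`, equipped with the canonical `G_v`-action", §3.6 p. 19): the
action on `K̄^×` restricts since `|g·a| = |a|`. [cite: LANA2026Report, §3.6 p. 19] -/
instance unitGrp.instMulDistribMulAction : MulDistribMulAction G (unitGrp w) where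
  smul g u := ⟨Units.map (MulDistribMulAction.toMonoidHom K g) (u : Kˣ), by
    rw [mem_unitGrp_iff, Units.coe_map, MulDistribMulAction.toMonoidHom_apply,
      IsValPreserving.val_smul]
    exact u.2⟩
  one_smul u := Subtype.ext (Units.ext (one_smul G ((u : Kˣ) : K)))
  mul_smul g h u := Subtype.ext (Units.ext (mul_smul g h ((u : Kˣ) : K)))
  smul_mul g u v := Subtype.ext (Units.ext (smul_mul' g ((u : Kˣ) : K) ((v : Kˣ) : K)))
  smul_one g := Subtype.ext (Units.ext (smul_one g))

/-- The action on `O^×`, on underlying elements of `K̄`. [cite: LANA2026Report, §3.6 p. 19] -/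
@[simp] theorem unitGrp.coe_smul (g : G) (u : unitGrp w) :
    (((g • u : unitGrp w) : Kˣ) : K) = g • ((u : Kˣ) : K) := rfl

/-- The endomorphism `u ↦ g·u` of `O^×` carries `O^μ` into `O^μ` (torsion to torsion), so the action
descends to `O^{×μ} = O^×/O^μ`. [cite: LANA2026Report, §3.6 p. 20] -/
theorem torsionUnits_le_comap (g : G) :
    torsionUnits w ≤ (torsionUnits w).comap (MulDistribMulAction.toMonoidHom (unitGrp w) g) :=
  CommGroup.le_comap_torsion _

/-- `g ↦ (O^{×μ} → O^{×μ})`, the descended endomorphism. [cite: LANA2026Report, §3.6 p. 20] -/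
def UnitsModTorsion.smulHom (g : G) : UnitsModTorsion w →* UnitsModTorsion w :=
  QuotientGroup.map _ _ (MulDistribMulAction.toMonoidHom (unitGrp w) g) (torsionUnits_le_comap w G g)

/-- The descended endomorphism on classes: `g·[u] = [g·u]`. [cite: LANA2026Report, §3.6 p. 20] -/
@[simp] theorem UnitsModTorsion.smulHom_mk (g : G) (u : unitGrp w) :
    UnitsModTorsion.smulHom w G g (u : UnitsModTorsion w) = ((g • u : unitGrp w) : UnitsModTorsion w) :=
  rfl

/-- **`G_v ↷ O^{×μ}_v`** (§3.6 p. 20: "This object is chosen, in the actual Θ-link in IUT theory, as an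
object to be shared, and hence is coric"): the `G`-action on `O^×/O^μ` induced from `G ↷ O^×`.
[cite: LANA2026Report, §3.6 p. 20] -/
instance UnitsModTorsion.instMulDistribMulAction : MulDistribMulAction G (UnitsModTorsion w) where
  smul g q := UnitsModTorsion.smulHom w G g q
  one_smul q := QuotientGroup.induction_on q fun u => by
    change UnitsModTorsion.smulHom w G 1 (u : UnitsModTorsion w) = u
    rw [UnitsModTorsion.smulHom_mk, one_smul]
  mul_smul g h q := QuotientGroup.induction_on q fun u => by
    change UnitsModTorsion.smulHom w G (g * h) (u : UnitsModTorsion w) =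
      UnitsModTorsion.smulHom w G g (UnitsModTorsion.smulHom w G h (u : UnitsModTorsion w))
    rw [UnitsModTorsion.smulHom_mk, UnitsModTorsion.smulHom_mk, UnitsModTorsion.smulHom_mk, mul_smul]
  smul_mul g q q' := map_mul (UnitsModTorsion.smulHom w G g) q q'
  smul_one g := map_one (UnitsModTorsion.smulHom w G g)

/-- The action on `O^{×μ}`, on classes: `g·[u] = [g·u]` — the projection `O^× ↠ O^{×μ}` is
`G`-equivariant. [cite: LANA2026Report, §3.6 p. 20] -/
@[simp] theorem UnitsModTorsion.smul_mk (g : G) (u : unitGrp w) :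
    (g • ((u : UnitsModTorsion w)) : UnitsModTorsion w) = ((g • u : unitGrp w) : UnitsModTorsion w) :=
  rfl

/-! ## 4. Invariants and the `×μ`-Kummer structure (§3.9, Def. 3.9.1) -/

/-- `(O^×)^H`, the `H`-invariants of `O^×` for a subgroup `H < G` (openness: modelling note (i)).
[cite: LANA2026Report, Def. 3.9.1 p. 22] -/
def unitInvariants (H : Subgroup G) : Subgroup (unitGrp w) := FixedPoints.subgroup H (unitGrp w)

/-- Membership in `(O^×)^H`. [cite: LANA2026Report, Def. 3.9.1 p. 22] -/
theorem mem_unitInvariants_iff (H : Subgroup G) (u : unitGrp w) :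
    u ∈ unitInvariants w G H ↔ ∀ h : H, (h : G) • u = u :=
  FixedPoints.mem_subgroup H (unitGrp w) u

/-- Fewer invariants under a bigger group: `H ≤ H′ ⟹ (O^×)^{H′} ≤ (O^×)^H`. [folklore] -/
theorem unitInvariants_antitone {H H' : Subgroup G} (hle : H ≤ H') :
    unitInvariants w G H' ≤ unitInvariants w G H := fun u hu => by
  rw [mem_unitInvariants_iff] at *
  exact fun h => hu ⟨h, hle h.2⟩

/-- **LANA Def. 3.9.1 (`×μ`-Kummer structure / compact structure)**: "For every open subgroup `H < G_v` of
`G_v`, define `I^κ_H` to be the image of `(O^×_v)^H` under `O^×_v ↠ O^{×μ}_v`. The resulting family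
`{I^κ_H}_{H < G_v open}` is called the `×μ`-Kummer structure or compact structure of `G_v ↷ O^{×μ}_v`."
[cite: LANA2026Report, Def. 3.9.1 p. 22] -/
def kummerStructure (H : Subgroup G) : Subgroup (UnitsModTorsion w) :=
  (unitInvariants w G H).map (toUnitsModTorsion w)

/-- Membership in `I^κ_H`: classes of `H`-invariant units. [cite: LANA2026Report, Def. 3.9.1 p. 22] -/
theorem mem_kummerStructure_iff (H : Subgroup G) (q : UnitsModTorsion w) :
    q ∈ kummerStructure w G H ↔ ∃ u ∈ unitInvariants w G H, (u : UnitsModTorsion w) = q :=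
  Subgroup.mem_map

/-- `H ≤ H′ ⟹ I^κ_{H′} ≤ I^κ_H`. [folklore] -/
theorem kummerStructure_antitone {H H' : Subgroup G} (hle : H ≤ H') :
    kummerStructure w G H' ≤ kummerStructure w G H :=
  Subgroup.map_mono (unitInvariants_antitone w G hle)

/-- **§3.9 p. 21**, the versions without an overline: "`O^▷_v := (O^▷_v)^{G_v}`".
[cite: LANA2026Report, §3.9 p. 21] -/
def intMonoidInv : Submonoid (intMonoid w) := FixedPoints.submonoid G (intMonoid w)

/-- **§3.9 p. 21**: "`O^×_v := (O^×_v)^{G_v}`". [cite: LANA2026Report, §3.9 p. 21] -/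
def unitInv : Subgroup (unitGrp w) := unitInvariants w G ⊤

/-- **§3.9 p. 21**: "the version without an overline of `O^{×μ}_v` is defined as the image of
`O^×_v := (O^×_v)^{G_v} → O^{×μ}_v`", i.e. `I^κ_{G_v}`; "Here, we note that `O^{×μ}_v` cannot be determined from
the abstract GM-data `G_v ↷ O^{×μ}_v` alone" (modelling note (iii)) — whence the compact structure as extra
datum. [cite: LANA2026Report, §3.9 p. 21] -/
def unitsModTorsionBare : Subgroup (UnitsModTorsion w) := kummerStructure w G ⊤

/-- The bare `O^{×μ}_v` is the top member `I^κ_{G_v}` of the compact structure, and every `I^κ_H`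
contains it. [cite: LANA2026Report, §3.9 p. 21, Def. 3.9.1 p. 22] -/
theorem unitsModTorsionBare_le_kummerStructure (H : Subgroup G) :
    unitsModTorsionBare w G ≤ kummerStructure w G H :=
  kummerStructure_antitone w G le_top

/-- `(MF)` numerator: §5.1 (c) p. 27 builds the mono-analytic Frobenius-like log-shell from exactly this
datum, "`I_v(F^{⊢×μ}) = (2p_v)⁻¹ · Im(I^κ_{G_v} ↪ O^{×μ}_v)`" — the member `I^κ_{G_v}` of the compact
structure (the factor `(2p_v)⁻¹` and the additive structure via `log` are LLANA-SPEC N10, not here).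
[cite: LANA2026Report, §5.1 (c) p. 27] -/
theorem kummerStructure_top_eq : kummerStructure w G ⊤ = unitsModTorsionBare w G := rfl

end Action

/-! ## 5. What the compact structure sees: invariance and `G_v`-equivariance (§3.9, Def. 4.1.2 (2)) -/

section Equivariance

variable {K : Type} [Field K] {Γ₀ : Type} [LinearOrderedCommGroupWithZero Γ₀] (w : Valuation K Γ₀)
  (G : Type) [Group G] [MulSemiringAction G K] [IsValPreserving w G]

/-- **§3.9 p. 21, the honest half of "`O^{×μ}_v` cannot be determined from the abstract GM-data
`G_v ↷ O^{×μ}_v` alone"**: the image `I^κ_H` of the `H`-invariant units consists of `H`-INVARIANT classes —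
`I^κ_H ≤ (O^{×μ})^H`; the report's point is that the converse containment fails in general (invariant classes
need not lift to invariant units), whence the compact structure as an extra datum (Def. 3.9.1).
[cite: LANA2026Report, §3.9 p. 21] -/
theorem kummerStructure_le_fixedPoints (H : Subgroup G) :
    kummerStructure w G H ≤ FixedPoints.subgroup H (UnitsModTorsion w) := by
  intro q hq
  obtain ⟨u, hu, rfl⟩ := (mem_kummerStructure_iff w G H q).mp hq
  rw [FixedPoints.mem_subgroup]
  intro h
  change (h : G) • ((u : UnitsModTorsion w)) = u
  rw [UnitsModTorsion.smul_mk, (mem_unitInvariants_iff w G H u).mp hu h]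

/-- `g` carries `H`-invariant units to `gHg⁻¹`-invariant units. [folklore] -/
theorem smul_mem_unitInvariants_conj (H : Subgroup G) (g : G) {u : unitGrp w}
    (hu : u ∈ unitInvariants w G H) : g • u ∈ unitInvariants w G (H.map (MulAut.conj g).toMonoidHom) := by
  rw [mem_unitInvariants_iff] at hu ⊢
  rintro ⟨_, ⟨h, hh, rfl⟩⟩
  change (MulAut.conj g h) • g • u = g • u
  rw [MulAut.conj_apply, ← mul_smul, inv_mul_cancel_right, mul_smul, hu ⟨h, hh⟩]

/-- **`G_v`-equivariance of the `×μ`-Kummer structure**: `g · I^κ_H = I^κ_{gHg⁻¹}` — so every `g ∈ G_v`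
(acting on `O^{×μ}_v`, conjugating on `G_v`) is an automorphism of the datum `(G_v ↷ O^{×μ}_v, {I^κ_H}_H)`
in the sense of Def. 4.1.2 (2) ("`ϕ_M(N_H) = N′_{ϕ_G(H)}`"): the inner part of (Ind1) comes paired with
an (Ind2)-component. [cite: LANA2026Report, Def. 4.1.2 p. 23, §6 p. 31] -/
theorem smul_kummerStructure (H : Subgroup G) (g : G) :
    (kummerStructure w G H).map (MulDistribMulAction.toMonoidHom (UnitsModTorsion w) g) =
      kummerStructure w G (H.map (MulAut.conj g).toMonoidHom) := by
  apply le_antisymm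
  · rintro _ ⟨q, hq, rfl⟩
    obtain ⟨u, hu, rfl⟩ := (mem_kummerStructure_iff w G H q).mp hq
    rw [MulDistribMulAction.toMonoidHom_apply, UnitsModTorsion.smul_mk]
    exact (mem_kummerStructure_iff w G _ _).mpr ⟨g • u, smul_mem_unitInvariants_conj w G H g hu, rfl⟩
  · intro q hq
    obtain ⟨u, hu, rfl⟩ := (mem_kummerStructure_iff w G _ q).mp hq
    have hu' : g⁻¹ • u ∈ unitInvariants w G H := by
      rw [mem_unitInvariants_iff] at hu ⊢
      intro h
      have hmem : g * h * g⁻¹ ∈ H.map (MulAut.conj g).toMonoidHom :=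
        Subgroup.mem_map.mpr ⟨h, h.2, by simp [MulAut.conj_apply]⟩
      have hfix := hu ⟨g * h * g⁻¹, hmem⟩
      change (g * h * g⁻¹) • u = u at hfix
      change (h : G) • g⁻¹ • u = g⁻¹ • u
      rw [← mul_smul, show (h : G) * g⁻¹ = g⁻¹ * (g * h * g⁻¹) by
        rw [← mul_assoc, ← mul_assoc, inv_mul_cancel, one_mul], mul_smul, hfix]
    refine ⟨((g⁻¹ • u : unitGrp w) : UnitsModTorsion w), ?_, ?_⟩
    · exact (mem_kummerStructure_iff w G H _).mpr ⟨g⁻¹ • u, hu', rfl⟩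
    · rw [MulDistribMulAction.toMonoidHom_apply, UnitsModTorsion.smul_mk, smul_inv_smul]

end Equivariance

end IUTFork

end Summit.ABC
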